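import Literature.RepresentationTheory.HeisenbergGroup.ImplementerCocycle
import Literature.RepresentationTheory.HeisenbergGroup.SchrodingerModel
import Literature.NumberTheory.Automorphic.SmoothRepresentation
import HarnessLib

/-!
# Galois (`Aut ℂ`) twist of the smooth Schrödinger model: `σ ∘ 𝒮(X)`, `ρ_ψ ↦ ρ_{σ∘ψ}`, and transport of implementers

Topic `RepresentationTheory/HeisenbergGroup`; namespace `Literature.RepresentationTheory.HeisenbergGroup`.
KERNEL ONLY: definitions with bodies and proved theorems; no named fact, no `sorry`.

For a field endomorphism `τ : ℂ →+* ℂ` (in applications an automorphism `σ ∈ Aut(ℂ)`, or complex conjugation) the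
post-composition `f ↦ τ ∘ f` preserves the Schwartz–Bruhat space `𝒮(X)` of locally constant compactly supported
functions on ANY topological space `X` and is `τ`-SEMILINEAR (`schwartzGalConj τ : 𝒮(X) →ₛₗ[τ] 𝒮(X)`, §1).  For the
smooth Schrödinger model `ρ_ψ = schrodingerSB β ψ` of the polarised Heisenberg group (`SchrodingerModel.lean`:
`(ρ_ψ((x,y),t) f)(u) = ψ(t + β(u,y)) f(u + x)`) and a second character `ψ'` with `τ ∘ ψ = ψ'` pointwise, it
INTERTWINES `ρ_ψ` with `ρ_{ψ'}` (§2, `schwartzGalConj_schrodingerSB`): `τ ∘ (ρ_ψ(h) f) = ρ_{ψ'}(h) (τ ∘ f)` — the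
Galois twist of the oscillator representation attached to `ψ` is the oscillator representation attached to `τ ∘ ψ`
([MoeglinVignerasWaldspurger1987, Chap. 2 II.1]: transport of structure; for `τ` = complex conjugation this is
`ω̄_ψ = ω_{ψ̄}`, [Li1992, p. 181], done adelically in `Weil1964/AdelicMetaplecticFinRepConj.lean`).  Consequently
(§3), for two mutually inverse endomorphisms `τ, τ'` (i.e. an automorphism and its inverse, kept as two ring
homomorphisms so that consumers may feed any coercion of an `AlgEquiv`/`RingEquiv`), the `ℂ`-LINEAR sandwich
`M ↦ τ ∘ M ∘ τ'` (`galSandwich`, `galSandwichEquiv`) carries implementers of `g ∈ Sp(W)` for `ρ_ψ` (MVW's condition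
(A)) to implementers of the SAME `g` for `ρ_{ψ'}` (`Implements.galSandwich`), whence a homomorphism of the metaplectic
groups of pairs `MpPsi.galTwist : S̃p_ψ(W) →* S̃p_{ψ'}(W)` over the identity of `Sp(W)` (`MpPsi.proj_galTwist`), inverse to
the twist along `(τ', τ)` (`MpPsi.galTwist_galTwist`), with `ω(galTwist p)(τ ∘ f) = τ ∘ (ω(p) f)`
(`MpPsi.toRep_galTwist_schwartzGalConj`).  §4: for a homomorphism `s : G →* S̃p_ψ(W)` (a splitting of a subgroup of
`Sp(W)`), the twisted splitting `galTwist ∘ s` lies over the same map to `Sp(W)`, its Weil representation is the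
`τ`-twist of that of `s` (`toRep_galTwist_comp_apply`), and smoothness is preserved (`isSmooth_galTwist_comp`).

This is piece (P3a) «local `Aut(ℂ)`-twist calculus of the Schrödinger package» of the cell `hodgecm-mathlib`'s road
to [Liu2021, Thm 4.18 (3)] (ε-rigidity under Galois twist; road memo A-p19 v2, 2026-08-28): with `ψ' = ψ(κ ·)`,
`κ = χ_cyc(σ)`, it identifies the `σ`-twist of the local oscillator representation at `ψ_v` with the oscillator
representation at `ψ_v(κ ·)`, WITHOUT root numbers or dichotomy signs.  Nothing here is specific to local fields:
`X` is any topological space and `ψ, ψ'` any locally constant characters related by `τ`.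
HC_CM is proved only modulo the 7 printed citations until rung 0 of the ladder closes; nothing about it is claimed here.

## References
* [MoeglinVignerasWaldspurger1987] C. Mœglin, M.-F. Vignéras, J.-L. Waldspurger, *Correspondances de Howe sur un corps
  p-adique*, LNM 1291 (1987), Chap. 2 I.4 Exemple (1) (the model on `𝒮`), II.1 (A)–(B) (the group of pairs; transport
  of structure).
* [Li1992] J.-S. Li, J. reine angew. Math. 428 (1992), p. 181 («`ω*` … is the same as `ω_{ψ̄}`»).
* [Liu2021] Y. Liu, Camb. J. Math. 9 (2021), Thm. 4.18 (3) and its proof l. 2272–2289 (the consumer).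
-/

set_option autoImplicit false

noncomputable section

namespace Literature.RepresentationTheory.HeisenbergGroup

open Literature.NumberTheory.Automorphic (SchwartzBruhat mem_schwartzBruhat_iff)

universe u v w

/-! ## §1 `f ↦ τ ∘ f` on the Schwartz–Bruhat space -/

section SB

variable {X : Type v} [TopologicalSpace X]

/-- post-composition with a field endomorphism preserves `𝒮(X)` (locally constant, compact support: `τ 0 = 0`).
[cite: MoeglinVignerasWaldspurger1987, Chap. 2 II.1 (transport of structure)] -/
theorem comp_mem_schwartzBruhat (τ : ℂ →+* ℂ) {f : X → ℂ} (hf : f ∈ SchwartzBruhat X) :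
    (τ : ℂ → ℂ) ∘ f ∈ SchwartzBruhat X :=
  mem_schwartzBruhat_iff.2 ⟨(mem_schwartzBruhat_iff.1 hf).1.comp τ, (mem_schwartzBruhat_iff.1 hf).2.comp_left (map_zero τ)⟩

/-- **the `τ`-semilinear map `f ↦ τ ∘ f` of `𝒮(X)`** (`τ : ℂ →+* ℂ` a field endomorphism; for `τ` = complex
conjugation this is the `C_f` of `Weil1964/AdelicMetaplecticFinRepConj`). [cite: MoeglinVignerasWaldspurger1987, Chap. 2 II.1 (transport of structure)] -/
def schwartzGalConj (τ : ℂ →+* ℂ) : SchwartzBruhat X →ₛₗ[τ] SchwartzBruhat X where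
  toFun f := ⟨(τ : ℂ → ℂ) ∘ (f : X → ℂ), comp_mem_schwartzBruhat τ f.2⟩
  map_add' f g := by
    apply Subtype.ext
    funext u
    exact map_add τ _ _
  map_smul' c f := by
    apply Subtype.ext
    funext u
    exact map_mul τ _ _

/-- underlying function: `τ ∘ f`. [cite: MoeglinVignerasWaldspurger1987, Chap. 2 II.1 (transport of structure)] -/
@[simp] theorem coe_schwartzGalConj (τ : ℂ →+* ℂ) (f : SchwartzBruhat X) :
    ((schwartzGalConj τ f : SchwartzBruhat X) : X → ℂ) = (τ : ℂ → ℂ) ∘ (f : X → ℂ) := rfl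

/-- pointwise formula `(τ ∘ f)(u) = τ (f u)`. [cite: MoeglinVignerasWaldspurger1987, Chap. 2 II.1 (transport of structure)] -/
theorem schwartzGalConj_apply (τ : ℂ →+* ℂ) (f : SchwartzBruhat X) (u : X) :
    ((schwartzGalConj τ f : SchwartzBruhat X) : X → ℂ) u = τ ((f : X → ℂ) u) := rfl

/-- `f ↦ τ ∘ f` is injective (a field endomorphism is injective). [cite: MoeglinVignerasWaldspurger1987, Chap. 2 II.1 (transport of structure)] -/
theorem schwartzGalConj_injective (τ : ℂ →+* ℂ) : Function.Injective (schwartzGalConj (X := X) τ) := by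
  intro f g h
  apply Subtype.ext
  funext u
  have := congrArg (fun k : SchwartzBruhat X => ((k : SchwartzBruhat X) : X → ℂ) u) h
  exact τ.injective this

/-- mutually inverse endomorphisms give mutually inverse twists: `τ ∘ (τ' ∘ f) = f` when `τ ∘ τ' = id`.
[cite: MoeglinVignerasWaldspurger1987, Chap. 2 II.1 (transport of structure)] -/
theorem schwartzGalConj_schwartzGalConj (τ τ' : ℂ →+* ℂ) (hττ' : ∀ z, τ (τ' z) = z) (f : SchwartzBruhat X) :
    schwartzGalConj τ (schwartzGalConj τ' f) = f := by
  apply Subtype.ext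
  funext u
  exact hττ' _

/-- for an automorphism (given with its inverse) `f ↦ τ ∘ f` is bijective on `𝒮(X)`. [cite: MoeglinVignerasWaldspurger1987, Chap. 2 II.1 (transport of structure)] -/
theorem schwartzGalConj_bijective (τ τ' : ℂ →+* ℂ) (hττ' : ∀ z, τ (τ' z) = z) :
    Function.Bijective (schwartzGalConj (X := X) τ) :=
  ⟨schwartzGalConj_injective τ, fun g => ⟨schwartzGalConj τ' g, schwartzGalConj_schwartzGalConj τ τ' hττ' g⟩⟩

/-- the identity endomorphism twists trivially. [cite: MoeglinVignerasWaldspurger1987, Chap. 2 II.1 (transport of structure)] -/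
@[simp] theorem schwartzGalConj_id (f : SchwartzBruhat X) : schwartzGalConj (RingHom.id ℂ) f = f :=
  Subtype.ext rfl

/-- **the `ℂ`-linear sandwich** `M ↦ τ ∘ M ∘ τ'` of a `ℂ`-linear endomorphism of `𝒮(X)` along two mutually inverse
field endomorphisms. [cite: MoeglinVignerasWaldspurger1987, Chap. 2 II.1 (transport of structure)] -/
def galSandwich (τ τ' : ℂ →+* ℂ) (hττ' : ∀ z, τ (τ' z) = z) (M : SchwartzBruhat X →ₗ[ℂ] SchwartzBruhat X) :
    SchwartzBruhat X →ₗ[ℂ] SchwartzBruhat X where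
  toFun f := schwartzGalConj τ (M (schwartzGalConj τ' f))
  map_add' f g := by rw [map_add, map_add, map_add]
  map_smul' c f := by
    rw [LinearMap.map_smulₛₗ, LinearMap.map_smul, LinearMap.map_smulₛₗ, hττ', RingHom.id_apply]

/-- pointwise formula of the sandwich. [cite: MoeglinVignerasWaldspurger1987, Chap. 2 II.1 (transport of structure)] -/
@[simp] theorem galSandwich_apply (τ τ' : ℂ →+* ℂ) (hττ' : ∀ z, τ (τ' z) = z)
    (M : SchwartzBruhat X →ₗ[ℂ] SchwartzBruhat X) (f : SchwartzBruhat X) :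
    galSandwich τ τ' hττ' M f = schwartzGalConj τ (M (schwartzGalConj τ' f)) := rfl

/-- the sandwich is multiplicative (`τ' ∘ τ = id` in the middle). [cite: MoeglinVignerasWaldspurger1987, Chap. 2 II.1 (transport of structure)] -/
theorem galSandwich_mul (τ τ' : ℂ →+* ℂ) (hττ' : ∀ z, τ (τ' z) = z) (hτ'τ : ∀ z, τ' (τ z) = z)
    (A B : SchwartzBruhat X →ₗ[ℂ] SchwartzBruhat X) :
    galSandwich τ τ' hττ' (A * B) = galSandwich τ τ' hττ' A * galSandwich τ τ' hττ' B := by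
  apply LinearMap.ext
  intro f
  simp only [Module.End.mul_apply, galSandwich_apply, schwartzGalConj_schwartzGalConj τ' τ hτ'τ]

/-- the sandwich of the identity is the identity (`τ ∘ τ' = id`). [cite: MoeglinVignerasWaldspurger1987, Chap. 2 II.1 (transport of structure)] -/
theorem galSandwich_one (τ τ' : ℂ →+* ℂ) (hττ' : ∀ z, τ (τ' z) = z) :
    galSandwich (X := X) τ τ' hττ' 1 = 1 := by
  apply LinearMap.ext
  intro f
  simp only [galSandwich_apply, Module.End.one_apply, schwartzGalConj_schwartzGalConj τ τ' hττ']

/-- the sandwich of a linear AUTOMORPHISM, again an automorphism (inverse = sandwich of the inverse).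
[cite: MoeglinVignerasWaldspurger1987, Chap. 2 II.1 (transport of structure)] -/
def galSandwichEquiv (τ τ' : ℂ →+* ℂ) (hττ' : ∀ z, τ (τ' z) = z) (hτ'τ : ∀ z, τ' (τ z) = z)
    (M : SchwartzBruhat X ≃ₗ[ℂ] SchwartzBruhat X) : SchwartzBruhat X ≃ₗ[ℂ] SchwartzBruhat X :=
  { galSandwich τ τ' hττ' M.toLinearMap with
    invFun := galSandwich τ τ' hττ' M.symm.toLinearMap
    left_inv := fun f => by
      simp only [LinearMap.toFun_eq_coe, galSandwich_apply, LinearEquiv.coe_coe,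
        schwartzGalConj_schwartzGalConj τ' τ hτ'τ, LinearEquiv.symm_apply_apply,
        schwartzGalConj_schwartzGalConj τ τ' hττ']
    right_inv := fun f => by
      simp only [LinearMap.toFun_eq_coe, galSandwich_apply, LinearEquiv.coe_coe,
        schwartzGalConj_schwartzGalConj τ' τ hτ'τ, LinearEquiv.apply_symm_apply,
        schwartzGalConj_schwartzGalConj τ τ' hττ'] }

/-- pointwise formula of the sandwiched automorphism. [cite: MoeglinVignerasWaldspurger1987, Chap. 2 II.1 (transport of structure)] -/
@[simp] theorem galSandwichEquiv_apply (τ τ' : ℂ →+* ℂ) (hττ' : ∀ z, τ (τ' z) = z) (hτ'τ : ∀ z, τ' (τ z) = z)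
    (M : SchwartzBruhat X ≃ₗ[ℂ] SchwartzBruhat X) (f : SchwartzBruhat X) :
    galSandwichEquiv τ τ' hττ' hτ'τ M f = schwartzGalConj τ (M (schwartzGalConj τ' f)) := rfl

/-- the sandwich of automorphisms is multiplicative. [cite: MoeglinVignerasWaldspurger1987, Chap. 2 II.1 (transport of structure)] -/
theorem galSandwichEquiv_mul (τ τ' : ℂ →+* ℂ) (hττ' : ∀ z, τ (τ' z) = z) (hτ'τ : ∀ z, τ' (τ z) = z)
    (M N : SchwartzBruhat X ≃ₗ[ℂ] SchwartzBruhat X) :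
    galSandwichEquiv τ τ' hττ' hτ'τ (M * N) = galSandwichEquiv τ τ' hττ' hτ'τ M * galSandwichEquiv τ τ' hττ' hτ'τ N := by
  apply LinearEquiv.ext
  intro f
  simp only [LinearEquiv.mul_apply, galSandwichEquiv_apply, schwartzGalConj_schwartzGalConj τ' τ hτ'τ]

/-- the sandwich of the identity automorphism is the identity. [cite: MoeglinVignerasWaldspurger1987, Chap. 2 II.1 (transport of structure)] -/
theorem galSandwichEquiv_one (τ τ' : ℂ →+* ℂ) (hττ' : ∀ z, τ (τ' z) = z) (hτ'τ : ∀ z, τ' (τ z) = z) :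
    galSandwichEquiv (X := X) τ τ' hττ' hτ'τ 1 = 1 := by
  apply LinearEquiv.ext
  intro f
  exact schwartzGalConj_schwartzGalConj τ τ' hττ' f

end SB

/-! ## §2 `τ ∘ ρ_ψ(h) = ρ_{τ∘ψ}(h) ∘ τ`: the twist intertwines the Schrödinger models of `ψ` and `ψ' = τ ∘ ψ` -/

section Schrodinger

variable {R : Type u} [CommRing R] {X : Type v} {Y : Type w} [AddCommGroup X] [Module R X] [AddCommGroup Y]
  [Module R Y] (β : X →ₗ[R] Y →ₗ[R] R) [TopologicalSpace X] [TopologicalSpace R] [IsTopologicalAddGroup X]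
  (ψ ψ' : AddChar R Circle) (hl : IsLocallyConstant (⇑ψ : R → Circle)) (hl' : IsLocallyConstant (⇑ψ' : R → Circle))
  (hb : ∀ y : Y, Continuous fun u : X => β u y)

/-- **`τ ∘ (ρ_ψ(h) f) = ρ_{ψ'}(h) (τ ∘ f)`** whenever `τ ∘ ψ = ψ'` pointwise: the `τ`-twist of the smooth Schrödinger
model of `ψ` is the smooth Schrödinger model of `ψ' = τ ∘ ψ`, on the nose (`(ρ_ψ(h)f)(u) = ψ(t + β(u,y)) f(u+x)`).
[cite: MoeglinVignerasWaldspurger1987, Chap. 2 II.1 (transport of structure)] -/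
theorem schwartzGalConj_schrodingerSB (τ : ℂ →+* ℂ) (hτ : ∀ r : R, τ ((ψ r : Circle) : ℂ) = ((ψ' r : Circle) : ℂ))
    (h : Heisenberg (polar β)) (f : SchwartzBruhat X) :
    schwartzGalConj τ (schrodingerSB β ψ hl hb h f) = schrodingerSB β ψ' hl' hb h (schwartzGalConj τ f) := by
  apply Subtype.ext
  funext u
  rw [schwartzGalConj_apply, schrodingerSB_apply, schrodingerSB_apply, map_mul, hτ, schwartzGalConj_apply]

/-- the same as an identity of operators: `(τ∘·) ∘ ρ_ψ(h) = ρ_{ψ'}(h) ∘ (τ∘·)` (semilinear composition written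
pointwise). [cite: MoeglinVignerasWaldspurger1987, Chap. 2 II.1 (transport of structure)] -/
theorem schwartzGalConj_comp_schrodingerSB (τ : ℂ →+* ℂ) (hτ : ∀ r : R, τ ((ψ r : Circle) : ℂ) = ((ψ' r : Circle) : ℂ))
    (h : Heisenberg (polar β)) :
    (fun f => schwartzGalConj τ (schrodingerSB β ψ hl hb h f)) =
      fun f => schrodingerSB β ψ' hl' hb h (schwartzGalConj τ f) :=
  funext (schwartzGalConj_schrodingerSB β ψ ψ' hl hl' hb τ hτ h)

omit [TopologicalSpace R] in
/-- if `τ ∘ ψ = ψ'` and `τ' ∘ τ = id` then `τ' ∘ ψ' = ψ`. [folklore] -/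
private theorem inv_character (τ τ' : ℂ →+* ℂ) (hτ'τ : ∀ z, τ' (τ z) = z)
    (hτ : ∀ r : R, τ ((ψ r : Circle) : ℂ) = ((ψ' r : Circle) : ℂ)) (r : R) :
    τ' ((ψ' r : Circle) : ℂ) = ((ψ r : Circle) : ℂ) := by
  rw [← hτ, hτ'τ]

/-! ## §3 Transport of implementers and the homomorphism `S̃p_ψ(W) →* S̃p_{ψ'}(W)` -/

/-- **condition (A) is transported by the sandwich**: if `M` implements `s ∈ B₀(W)` for `ρ_ψ`
(`M ρ_ψ(h) = ρ_ψ(s·h) M`), then `τ ∘ M ∘ τ'` implements the SAME `s` for `ρ_{ψ'}`, `ψ' = τ ∘ ψ`, `τ' = τ⁻¹`.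
[cite: MoeglinVignerasWaldspurger1987, Chap. 2 II.1 (A)] -/
theorem Implements.galSandwich (τ τ' : ℂ →+* ℂ) (hττ' : ∀ z, τ (τ' z) = z) (hτ'τ : ∀ z, τ' (τ z) = z)
    (hτ : ∀ r : R, τ ((ψ r : Circle) : ℂ) = ((ψ' r : Circle) : ℂ)) {s : Heisenberg.PseudoSymplectic (polar β)}
    {M : SchwartzBruhat X ≃ₗ[ℂ] SchwartzBruhat X} (hM : Implements (schrodingerSB β ψ hl hb) s M) :
    Implements (schrodingerSB β ψ' hl' hb) s (galSandwichEquiv τ τ' hττ' hτ'τ M) := by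
  intro h f
  rw [galSandwichEquiv_apply, galSandwichEquiv_apply,
    schwartzGalConj_schrodingerSB β ψ' ψ hl' hl hb τ' (inv_character ψ ψ' τ τ' hτ'τ hτ) h f, hM,
    schwartzGalConj_schrodingerSB β ψ ψ' hl hl' hb τ hτ]

variable [Invertible (2 : R)]

/-- **the Galois twist of the metaplectic group of pairs**: `(g, M) ↦ (g, τ ∘ M ∘ τ⁻¹)` is a homomorphism
`S̃p_ψ(W) →* S̃p_{ψ'}(W)` (`ψ' = τ ∘ ψ`). [cite: MoeglinVignerasWaldspurger1987, Chap. 2 II.1 (B)] -/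
def MpPsi.galTwist (τ τ' : ℂ →+* ℂ) (hττ' : ∀ z, τ (τ' z) = z) (hτ'τ : ∀ z, τ' (τ z) = z)
    (hτ : ∀ r : R, τ ((ψ r : Circle) : ℂ) = ((ψ' r : Circle) : ℂ)) :
    MpPsi (schrodingerSB β ψ hl hb) →* MpPsi (schrodingerSB β ψ' hl' hb) where
  toFun p := ⟨((p : symplecticGroup (polar β) × (SchwartzBruhat X ≃ₗ[ℂ] SchwartzBruhat X)).1,
      galSandwichEquiv τ τ' hττ' hτ'τ (p : symplecticGroup (polar β) × (SchwartzBruhat X ≃ₗ[ℂ] SchwartzBruhat X)).2),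
    (mem_MpPsi _ _).2 (Implements.galSandwich β ψ ψ' hl hl' hb τ τ' hττ' hτ'τ hτ ((mem_MpPsi _ _).1 p.2))⟩
  map_one' := by
    apply Subtype.ext
    exact Prod.ext rfl (galSandwichEquiv_one τ τ' hττ' hτ'τ)
  map_mul' p q := by
    apply Subtype.ext
    exact Prod.ext rfl (galSandwichEquiv_mul τ τ' hττ' hτ'τ _ _)

/-- components of the twisted pair: same `g`, sandwiched operator. [cite: MoeglinVignerasWaldspurger1987, Chap. 2 II.1 (B)] -/
@[simp] theorem MpPsi.coe_galTwist (τ τ' : ℂ →+* ℂ) (hττ' : ∀ z, τ (τ' z) = z) (hτ'τ : ∀ z, τ' (τ z) = z)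
    (hτ : ∀ r : R, τ ((ψ r : Circle) : ℂ) = ((ψ' r : Circle) : ℂ)) (p : MpPsi (schrodingerSB β ψ hl hb)) :
    ((MpPsi.galTwist β ψ ψ' hl hl' hb τ τ' hττ' hτ'τ hτ p : MpPsi (schrodingerSB β ψ' hl' hb)) :
        symplecticGroup (polar β) × (SchwartzBruhat X ≃ₗ[ℂ] SchwartzBruhat X)) =
      ((p : symplecticGroup (polar β) × (SchwartzBruhat X ≃ₗ[ℂ] SchwartzBruhat X)).1,
        galSandwichEquiv τ τ' hττ' hτ'τ (p : symplecticGroup (polar β) × (SchwartzBruhat X ≃ₗ[ℂ] SchwartzBruhat X)).2) :=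
  rfl

/-- **the twist lies over the identity of `Sp(W)`**: `proj (galTwist p) = proj p`. [cite: MoeglinVignerasWaldspurger1987, Chap. 2 II.1 (B)] -/
@[simp] theorem MpPsi.proj_galTwist (τ τ' : ℂ →+* ℂ) (hττ' : ∀ z, τ (τ' z) = z) (hτ'τ : ∀ z, τ' (τ z) = z)
    (hτ : ∀ r : R, τ ((ψ r : Circle) : ℂ) = ((ψ' r : Circle) : ℂ)) (p : MpPsi (schrodingerSB β ψ hl hb)) :
    MpPsi.proj _ (MpPsi.galTwist β ψ ψ' hl hl' hb τ τ' hττ' hτ'τ hτ p) = MpPsi.proj _ p := rfl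

/-- **`ω(galTwist p)(τ ∘ f) = τ ∘ (ω(p) f)`**: the twist `f ↦ τ ∘ f` intertwines the tautological representation
of `S̃p_ψ(W)` on `𝒮(X)` with that of `S̃p_{ψ'}(W)` along `galTwist`. [cite: MoeglinVignerasWaldspurger1987, Chap. 2 II.1 (B)] -/
theorem MpPsi.toRep_galTwist_schwartzGalConj (τ τ' : ℂ →+* ℂ) (hττ' : ∀ z, τ (τ' z) = z)
    (hτ'τ : ∀ z, τ' (τ z) = z) (hτ : ∀ r : R, τ ((ψ r : Circle) : ℂ) = ((ψ' r : Circle) : ℂ))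
    (p : MpPsi (schrodingerSB β ψ hl hb)) (f : SchwartzBruhat X) :
    MpPsi.toRep _ (MpPsi.galTwist β ψ ψ' hl hl' hb τ τ' hττ' hτ'τ hτ p) (schwartzGalConj τ f) =
      schwartzGalConj τ (MpPsi.toRep _ p f) := by
  rw [MpPsi.toRep_apply, MpPsi.coe_galTwist, galSandwichEquiv_apply, schwartzGalConj_schwartzGalConj τ' τ hτ'τ,
    MpPsi.toRep_apply]

/-- the same with the twisted vector on the right: `ω(galTwist p) f = τ ∘ (ω(p) (τ' ∘ f))`.
[cite: MoeglinVignerasWaldspurger1987, Chap. 2 II.1 (B)] -/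
theorem MpPsi.toRep_galTwist_apply (τ τ' : ℂ →+* ℂ) (hττ' : ∀ z, τ (τ' z) = z)
    (hτ'τ : ∀ z, τ' (τ z) = z) (hτ : ∀ r : R, τ ((ψ r : Circle) : ℂ) = ((ψ' r : Circle) : ℂ))
    (p : MpPsi (schrodingerSB β ψ hl hb)) (f : SchwartzBruhat X) :
    MpPsi.toRep _ (MpPsi.galTwist β ψ ψ' hl hl' hb τ τ' hττ' hτ'τ hτ p) f =
      schwartzGalConj τ (MpPsi.toRep _ p (schwartzGalConj τ' f)) := by
  rw [MpPsi.toRep_apply, MpPsi.coe_galTwist, galSandwichEquiv_apply, MpPsi.toRep_apply]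

/-- **twisting back**: the twist along `(τ', τ)` (from `ψ'` to `ψ`) inverts the twist along `(τ, τ')`; in particular
`galTwist` is a bijection `S̃p_ψ(W) ≃ S̃p_{ψ'}(W)`. [cite: MoeglinVignerasWaldspurger1987, Chap. 2 II.1 (B)] -/
theorem MpPsi.galTwist_galTwist (τ τ' : ℂ →+* ℂ) (hττ' : ∀ z, τ (τ' z) = z) (hτ'τ : ∀ z, τ' (τ z) = z)
    (hτ : ∀ r : R, τ ((ψ r : Circle) : ℂ) = ((ψ' r : Circle) : ℂ)) (p : MpPsi (schrodingerSB β ψ hl hb)) :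
    MpPsi.galTwist β ψ' ψ hl' hl hb τ' τ hτ'τ hττ' (inv_character ψ ψ' τ τ' hτ'τ hτ)
        (MpPsi.galTwist β ψ ψ' hl hl' hb τ τ' hττ' hτ'τ hτ p) = p := by
  apply Subtype.ext
  refine Prod.ext rfl ?_
  apply LinearEquiv.ext
  intro f
  simp only [MpPsi.coe_galTwist, galSandwichEquiv_apply, schwartzGalConj_schwartzGalConj τ' τ hτ'τ]

/-- `galTwist` is bijective. [cite: MoeglinVignerasWaldspurger1987, Chap. 2 II.1 (B)] -/
theorem MpPsi.galTwist_bijective (τ τ' : ℂ →+* ℂ) (hττ' : ∀ z, τ (τ' z) = z) (hτ'τ : ∀ z, τ' (τ z) = z)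
    (hτ : ∀ r : R, τ ((ψ r : Circle) : ℂ) = ((ψ' r : Circle) : ℂ)) :
    Function.Bijective (MpPsi.galTwist β ψ ψ' hl hl' hb τ τ' hττ' hτ'τ hτ) := by
  refine Function.bijective_iff_has_inverse.2
    ⟨MpPsi.galTwist β ψ' ψ hl' hl hb τ' τ hτ'τ hττ' (inv_character ψ ψ' τ τ' hτ'τ hτ),
      fun p => MpPsi.galTwist_galTwist β ψ ψ' hl hl' hb τ τ' hττ' hτ'τ hτ p, fun q => ?_⟩
  exact MpPsi.galTwist_galTwist β ψ' ψ hl' hl hb τ' τ hτ'τ hττ' (inv_character ψ ψ' τ τ' hτ'τ hτ) q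

/-! ## §4 Twisting a splitting `s : G →* S̃p_ψ(W)` -/

variable {G : Type*} [Group G]

/-- **the twisted splitting lies over the same map to `Sp(W)`**: `proj (galTwist (s g)) = proj (s g)`.
[cite: MoeglinVignerasWaldspurger1987, Chap. 2 II.1 (B)] -/
theorem MpPsi.proj_galTwist_comp (τ τ' : ℂ →+* ℂ) (hττ' : ∀ z, τ (τ' z) = z) (hτ'τ : ∀ z, τ' (τ z) = z)
    (hτ : ∀ r : R, τ ((ψ r : Circle) : ℂ) = ((ψ' r : Circle) : ℂ)) (s : G →* MpPsi (schrodingerSB β ψ hl hb)) (g : G) :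
    MpPsi.proj _ ((MpPsi.galTwist β ψ ψ' hl hl' hb τ τ' hττ' hτ'τ hτ).comp s g) = MpPsi.proj _ (s g) := rfl

/-- **the Weil representation of the twisted splitting is the `τ`-twist of that of `s`**:
`ω_{galTwist ∘ s}(g) (τ ∘ f) = τ ∘ (ω_s(g) f)`. [cite: MoeglinVignerasWaldspurger1987, Chap. 2 II.1 (B)] -/
theorem MpPsi.toRep_galTwist_comp_apply (τ τ' : ℂ →+* ℂ) (hττ' : ∀ z, τ (τ' z) = z) (hτ'τ : ∀ z, τ' (τ z) = z)
    (hτ : ∀ r : R, τ ((ψ r : Circle) : ℂ) = ((ψ' r : Circle) : ℂ)) (s : G →* MpPsi (schrodingerSB β ψ hl hb))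
    (g : G) (f : SchwartzBruhat X) :
    (MpPsi.toRep (schrodingerSB β ψ' hl' hb)).comp ((MpPsi.galTwist β ψ ψ' hl hl' hb τ τ' hττ' hτ'τ hτ).comp s) g
        (schwartzGalConj τ f) =
      schwartzGalConj τ ((MpPsi.toRep (schrodingerSB β ψ hl hb)).comp s g f) := by
  rw [MonoidHom.comp_apply, MonoidHom.comp_apply, MonoidHom.comp_apply]
  exact MpPsi.toRep_galTwist_schwartzGalConj β ψ ψ' hl hl' hb τ τ' hττ' hτ'τ hτ (s g) f

/-- **the stabiliser of `τ ∘ f` under the twisted splitting is the stabiliser of `f` under `s`**.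
[cite: MoeglinVignerasWaldspurger1987, Chap. 2 II.1 (B)] -/
theorem MpPsi.stabilizerSubgroup_galTwist_comp (τ τ' : ℂ →+* ℂ) (hττ' : ∀ z, τ (τ' z) = z)
    (hτ'τ : ∀ z, τ' (τ z) = z) (hτ : ∀ r : R, τ ((ψ r : Circle) : ℂ) = ((ψ' r : Circle) : ℂ))
    (s : G →* MpPsi (schrodingerSB β ψ hl hb)) (f : SchwartzBruhat X) :
    Representation.stabilizerSubgroup ((MpPsi.toRep (schrodingerSB β ψ' hl' hb)).comp
          ((MpPsi.galTwist β ψ ψ' hl hl' hb τ τ' hττ' hτ'τ hτ).comp s)) (schwartzGalConj τ f) =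
      Representation.stabilizerSubgroup ((MpPsi.toRep (schrodingerSB β ψ hl hb)).comp s) f := by
  ext g
  rw [Representation.mem_stabilizerSubgroup, Representation.mem_stabilizerSubgroup,
    MpPsi.toRep_galTwist_comp_apply]
  exact (schwartzGalConj_injective τ).eq_iff

/-- **smoothness is preserved by the Galois twist**: if `ω_s` is smooth (every vector has open stabiliser) then so
is `ω_{galTwist ∘ s}` (every vector is `τ ∘ f` for `f = τ' ∘ ·`, with the same stabiliser).
[cite: MoeglinVignerasWaldspurger1987, Chap. 2 II.8 (smooth vectors)] -/
theorem MpPsi.isSmooth_galTwist_comp [TopologicalSpace G] (τ τ' : ℂ →+* ℂ) (hττ' : ∀ z, τ (τ' z) = z)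
    (hτ'τ : ∀ z, τ' (τ z) = z) (hτ : ∀ r : R, τ ((ψ r : Circle) : ℂ) = ((ψ' r : Circle) : ℂ))
    (s : G →* MpPsi (schrodingerSB β ψ hl hb))
    (hs : Representation.IsSmooth ((MpPsi.toRep (schrodingerSB β ψ hl hb)).comp s)) :
    Representation.IsSmooth ((MpPsi.toRep (schrodingerSB β ψ' hl' hb)).comp
        ((MpPsi.galTwist β ψ ψ' hl hl' hb τ τ' hττ' hτ'τ hτ).comp s)) := by
  intro f'
  rw [Representation.isSmoothVector_iff, ← schwartzGalConj_schwartzGalConj τ τ' hττ' f',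
    MpPsi.stabilizerSubgroup_galTwist_comp]
  exact hs _

end Schrodinger

end Literature.RepresentationTheory.HeisenbergGroup

end
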